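import Summits.AtomisticToContinuum.HydrodynamicLimit.Theses.TwoClocks
import Literature.MathematicalPhysics.KineticTheory.HardSphereEulerProofs
import Literature.Analysis.FluidPDE.HardSphereFlowJointMeasurable
import Literature.Analysis.FluidPDE.LocalForecastCorrector
import Summits.AtomisticToContinuum.HydrodynamicLimit.Theorems.OneFlightGossipEngineKineticCurrentsWindowLDUniformWindowTransferOfRenyi
import HarnessLib

/-!
# Birth skeleton — crux `LocalGibbsTransfer` (stmt-AtomisticToContinuum-14443), route TwoClocks, line `birth`

`LocalGibbsTransfer := EquilibriumFastWindowLD → KineticWindowLDUniform` (rank 5, "LD currency makes local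
Gibbs data free"): the window large-deviation bound for fast one-body functionals transfers from GLOBAL
equilibrium data (constant profiles, flow-invariant canonical Gibbs law, thresholds pointwise in every
parameter) to smooth LOCAL Gibbs data, uniformly over dilute profiles (activity-ratio guard
`σ³·sup a ≤ η₀ ∫a`), thresholds pointwise in the data.

## Idea (the route's foreseen split "CorridorLocality → CellwiseEquivalence", typed)

Spatial transfer by macroscopic cells and corridors (KipnisLandim1999 Ch. 6 Lemma 1.8 sub-lattice Hölder
template; Spohn1991 Part I §2.3–2.4 local equilibrium statics; Ruelle1969 Ch. 3–4 low-activity hard-core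
statics): freeze the profiles on cells of side `δ(ε)`, discard corridor particles (bounded observable:
deterministic `o(N)`), localise the window functional of each cell by the range-`Rℓ_N` cluster forecast
(influence locality in bad-COUNT currency, stub 4), factorise over cells by the spatial Markov property of
the hard-core law given the corridor configuration, compare each cell with the canonical law of a cell
TORUS whose reduced density is TUNED EXACTLY to a finite density net chosen after `(β, ε)` (two free
parameters: torus side and particle number), and apply the equilibrium input there. The analysis of what
the equilibrium input must look like for this to close is the content of the cut:

* uniformity of the tilt radius `β₀` over weighted-sup-norm balls of observables, over frames
  `(θ₀(x₀), u₀(x₀))` in compact ranges, over freezing points `x₀ ∈ 𝕋³`, over flows, and eventually in the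
  window is SOFT — Baire category in the Banach space of admissible observables + Hölder + flow-invariance
  of the homogeneous Gibbs law + exact boost / thermal-scaling covariance + window monotonicity (all five
  mechanisms are LANDED for this route: `FastWindowRG.exists_uniform_range_of_baire`,
  `TransferEntropyClockBaire.uniform_radius_of_baire`, `TransferEntropyClockFrame.vMoment_frame`,
  `…lintegral_window_flow_indep`, `TransferEntropyClockWindows.stub_windowUpgrade`) — stub 2;
* uniformity of `β₀` in the REDUCED DENSITY `σ` over compact bands is NOT soft: no symmetry of the
  hard-sphere gas moves `σ` (activity is padding for a canonical homogeneous law —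
  `localGibbsLaw_const_activity`, evidence `ActivityPadding.lean` on this item; boosts and thermal scalings
  fix `σ`; `N ↦ k³N` tiling fixes `σ`), and two densities are two different dynamics with no `N`-uniform
  comparison at exponential scale. Cells of a non-constant activity profile live at a CONTINUUM of reduced
  densities `σ(a(x_b)/ā)^{1/3}`, and `β₀` is chosen before `ε`, i.e. before the cells: a band-uniform tilt
  radius is exactly the irreducible extra content of the implication — stub 1 (hardest). Only `β₀` needs
  it: the window `τ` and the threshold `N₀` may stay pointwise in `σ` because the transfer tunes every cell
  torus onto a FINITE density net fixed after `(β, ε)`.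

## Stubs (6; statements are the `@[stub "birth"]` Props of §1, sorries live in §2 only)

| stub | statement | size / status |
|---|---|---|
| `stub_densityBandUniformisation` | `EquilibriumFastWindowLD → EquilibriumDensityBandLD` | crux-sized (HARDEST): the density direction |
| `stub_frozenCoreReduction` | `EquilibriumDensityBandLD → FrozenEquilibriumCore` | L, provable-grade (Baire re-run over `x₀ ∈ 𝕋³`) |
| `stub_windowRenyi` | Rényi quasi-invariance of the local Gibbs law over a kinetic window | L; SHARED verbatim with line `sigma-uniform-equilibrium-transfer` of crux stmt-14662 |
| `stub_localInfluence` | window influence locality, bad-count currency, compact families | L; SHARED verbatim with the same line |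
| `stub_cellCorridorTransfer` | `LocalInfluenceLocality → FrozenEquilibriumCore → WindowTransfer → KineticWindowLDUniformBdd` | L–XL formalisation, standard mathematics |
| `stub_quadraticTruncation` | `WindowTransfer → KineticWindowLDUniformBdd → KineticWindowLDUniform` | M, provable-grade |

Landed inputs used BY NAME in the composition: `KineticCurrentsWindowLDUniformSketch.stub_windowTransfer_of_renyi`
(p89950; Rényi ⟹ the consumable `L^q` window transfer). The static freezing lemma of the sibling line is landed
too (`KineticCurrentsWindowLDUniformSigmaUniform.stub_staticFreezing`) and is a tool inside stub 5, not a stub.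

## Composition
`LocalGibbsTransfer_of h₁ h₂ h₃ h₄ h₅ h₆ : LocalGibbsTransfer :=
  fun hE => h₆ WT (h₅ h₄ (h₂ (h₁ hE)) WT)`, `WT := stub_windowTransfer_of_renyi h₃` — kernel-checked, no sorry
outside `stub_*`; the hypothesis `EquilibriumFastWindowLD` is CONSUMED (through stub 1).

## Disproof / negatives used
No `Disproof.lean` exists for this crux (crux dir empty at registration, 2026-08-17). `ledger negatives`
(HydrodynamicLimit): the two refuted TwoClocks statements are collisional (capped stmt-14441: dense-blob cage
virial; momentum-clamped stmt-13733: Newton-cradle energy relay) — no stub here is collisional or clamped; the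
refuted `∀ β` / `∀ N` shapes of the sibling disproof (`Cruxes/KineticCurrentsWindowLDUniform/Disproof.lean`
§1, §3) are honoured: every node keeps `∃ β₀` before `τ` and `∃ N₀`, and the equilibrium core carries a
density floor `σ₁ > 0` (false for the free gas). Refuter evidence on this item (EVIDENCE.md v2, Conv.lean,
ActivityPadding.lean) is what stub 1 answers: "K's activity profile changes local density, unreachable from A
by torus symmetries ⇒ transfer must re-run A's engine on boxes at every packing ≤ η₀".
-/

noncomputable section

open MeasureTheory Set Filter
open scoped ENNReal Topology Classical

namespace Summit.AtomisticToContinuum.HydrodynamicLimit.Cruxes.LocalGibbsTransfer.Birth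

open Literature.Analysis.FluidPDE (HardSphereFlow Config localMaxwellian canonicalDensity liouville
  localClusterState)
open Literature.MathematicalPhysics.KineticTheory (T3 V3 hsDiameter localGibbsLaw localGibbsMeasure
  localGibbsProfile)
open Summit.AtomisticToContinuum.HydrodynamicLimit.Theses.TwoClocks (EquilibriumFastWindowLD
  KineticWindowLDUniform LocalGibbsTransfer)

/-! ## §0 Intermediate nodes (plain `Prop`s over tree vocabulary) -/

/-- **Node `EquilibriumDensityBandLD` — crux 2 with a BAND-UNIFORM tilt radius.** Verbatim the frame of
`EquilibriumFastWindowLD` (universal `σ₀`; constants `a₀, θ₀ > 0`, `u₀`; canonical Gibbs law with constant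
profiles; continuous `F` of quadratic growth orthogonal under `M_{1,u₀,θ₀}` to `1, v_j, |v|²`; ONE window
`w = τ(N+1)^{-1/3}` per `(β, ε)`), with two changes: the tilt radius `β₀` is chosen BEFORE the reduced
density ranges over a compact band `[σ₁, σ₂] ⊂ (0, σ₀)` (the window `τ` and the threshold `N₀` stay
pointwise in `σ`), and the flow is quantified innermost (free: the law-level functional does not depend on
the flow, `lintegral_window_flow_indep`). -/
def EquilibriumDensityBandLD : Prop :=
  ∃ σ₀ : ℝ, 0 < σ₀ ∧ ∀ (a₀ θ₀ : ℝ) (u₀ : V3), 0 < a₀ → 0 < θ₀ →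
    ∀ σ₁ σ₂ : ℝ, 0 < σ₁ → σ₁ ≤ σ₂ → σ₂ < σ₀ →
    ∀ F : T3 × V3 → ℝ, Continuous F → (∃ C : ℝ, ∀ y, |F y| ≤ C * (1 + ‖y.2‖ ^ 2)) →
    (∀ x, ∫ v, F (x, v) * localMaxwellian 1 θ₀ u₀ v = 0) →
    (∀ x (j : Fin 3), ∫ v, F (x, v) * v j * localMaxwellian 1 θ₀ u₀ v = 0) →
    (∀ x, ∫ v, F (x, v) * ‖v‖ ^ 2 * localMaxwellian 1 θ₀ u₀ v = 0) →
    ∃ β₀ : ℝ, 0 < β₀ ∧ ∀ β : ℝ, |β| ≤ β₀ → ∀ ε : ℝ, 0 < ε → ∀ σ ∈ Set.Icc σ₁ σ₂,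
    ∃ τ : ℝ, 0 < τ ∧ ∃ N₀ : ℕ, ∀ N : ℕ, N₀ ≤ N →
    ∀ Φ : HardSphereFlow (Literature.Analysis.FluidPDE.Torus.geometry (Fin 3)) (hsDiameter σ N) (N + 1),
      ∫⁻ z, ENNReal.ofReal (Real.exp (β * ∑ i : Fin (N + 1),
          (τ * ((N : ℝ) + 1) ^ (-(1 / 3 : ℝ)))⁻¹ *
            ∫ r in (0 : ℝ)..(τ * ((N : ℝ) + 1) ^ (-(1 / 3 : ℝ))), F ((Φ.flow r z) i)))
        ∂(localGibbsLaw σ (fun _ => a₀) (fun _ => u₀) (fun _ => θ₀) N Φ) ≤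
      ENNReal.ofReal (Real.exp (ε * ((N : ℝ) + 1)))

/-- **Node `FrozenEquilibriumCore` — the equilibrium input in the shape the cell transfer consumes.**
Universal `σ₀`; for continuous frame profiles `θ₀ > 0`, `u₀` on `𝕋³`, a density band
`0 < σ₁ ≤ σ₂ < σ₀` and a growth constant `C` there is ONE tilt radius `β₀` (uniform over the freezing point,
the band and all BOUNDED admissible observables of growth `C`) such that for every bounded continuous
`F`, `|F| ≤ C(1+|v|²)`, orthogonal at every `x` under `M_{1,u₀(x),θ₀(x)}` to `1, v_j, |v|²`, every
`|β| ≤ β₀`, `ε > 0` and `σ` in the band (thresholds after `σ`): eventually in the window `τ ≥ τ₀`, with one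
threshold `N₀` for all freezing points `x₀` and all flows, the window functional of the FROZEN, velocity-only
observable `v ↦ F(x₀, v)` under the homogeneous canonical law with the frame of `x₀`,
`localGibbsLaw σ 1 (u₀ x₀) (θ₀ x₀)` (flow-invariant), has exponential moment `≤ e^{ε(N+1)}`. The
general-`F`, `σ`-pointwise-threshold twin of the sibling line's `stub_frozenEquilibriumCore`
(crux stmt-14662). -/
def FrozenEquilibriumCore : Prop :=
  ∃ σ₀ : ℝ, 0 < σ₀ ∧ ∀ (θ₀ : T3 → ℝ) (u₀ : T3 → V3), Continuous θ₀ → Continuous u₀ →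
    (∀ x, 0 < θ₀ x) → ∀ σ₁ σ₂ : ℝ, 0 < σ₁ → σ₁ ≤ σ₂ → σ₂ < σ₀ →
    ∀ C : ℝ, 0 ≤ C → ∃ β₀ : ℝ, 0 < β₀ ∧
    ∀ F : T3 × V3 → ℝ, Continuous F → (∃ B : ℝ, ∀ y, |F y| ≤ B) →
    (∀ y, |F y| ≤ C * (1 + ‖y.2‖ ^ 2)) →
    (∀ x, ∫ v, F (x, v) * localMaxwellian 1 (θ₀ x) (u₀ x) v = 0) →
    (∀ x (j : Fin 3), ∫ v, F (x, v) * v j * localMaxwellian 1 (θ₀ x) (u₀ x) v = 0) →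
    (∀ x, ∫ v, F (x, v) * ‖v‖ ^ 2 * localMaxwellian 1 (θ₀ x) (u₀ x) v = 0) →
    ∀ β : ℝ, |β| ≤ β₀ → ∀ ε : ℝ, 0 < ε → ∀ σ ∈ Set.Icc σ₁ σ₂,
    ∃ τ₀ : ℝ, 0 < τ₀ ∧ ∀ τ : ℝ, τ₀ ≤ τ → ∃ N₀ : ℕ, ∀ x₀ : T3, ∀ N : ℕ, N₀ ≤ N →
    ∀ Φ : HardSphereFlow (Literature.Analysis.FluidPDE.Torus.geometry (Fin 3)) (hsDiameter σ N) (N + 1),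
      ∫⁻ z, ENNReal.ofReal (Real.exp (β * ∑ i : Fin (N + 1),
          (τ * ((N : ℝ) + 1) ^ (-(1 / 3 : ℝ)))⁻¹ *
            ∫ r in (0 : ℝ)..(τ * ((N : ℝ) + 1) ^ (-(1 / 3 : ℝ))), F (x₀, ((Φ.flow r z) i).2)))
        ∂(localGibbsLaw σ (fun _ => 1) (fun _ => u₀ x₀) (fun _ => θ₀ x₀) N Φ) ≤
      ENNReal.ofReal (Real.exp (ε * ((N : ℝ) + 1)))

/-- **Node `WindowTransfer` — the consumable `L^q` window transfer under the local Gibbs law** (single-time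
expectations of non-negative functionals at any time of a kinetic window are `≤ e^{δ(N+1)}` times the
`L^q(λ^N)`-norm at time `0`). Verbatim the conclusion of the LANDED glue
`KineticCurrentsWindowLDUniformSketch.stub_windowTransfer_of_renyi` (= the sibling line `Sketch`'s
registered `stub_windowTransfer`), hence supplied here by `stub_windowRenyi`. -/
def WindowTransfer : Prop :=
  ∀ (a θ₀ : T3 → ℝ) (u₀ : T3 → V3), Continuous a → Continuous θ₀ → Continuous u₀ →
    (∀ x, 0 < a x) → (∀ x, 0 < θ₀ x) → ∀ σ : ℝ, 0 < σ → σ ≤ 1 / 2 →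
    ∃ q : ℝ, 1 ≤ q ∧ ∀ τ : ℝ, 0 < τ → ∀ δ : ℝ, 0 < δ →
    ∀ Φ : (N : ℕ) →
      HardSphereFlow (Literature.Analysis.FluidPDE.Torus.geometry (Fin 3)) (hsDiameter σ N) (N + 1),
    ∃ N₀ : ℕ, ∀ N : ℕ, N₀ ≤ N → ∀ r ∈ Set.Icc (0 : ℝ) (τ * ((N : ℝ) + 1) ^ (-(1 / 3 : ℝ))),
    ∀ G : Config (N + 1) (Fin 3) T3 → ℝ≥0∞, Measurable G →
      ∫⁻ z, G ((Φ N).flow r z) ∂(localGibbsLaw σ a u₀ θ₀ N (Φ N)) ≤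
        ENNReal.ofReal (Real.exp (δ * ((N : ℝ) + 1))) *
          (∫⁻ z, G z ^ q ∂(localGibbsLaw σ a u₀ θ₀ N (Φ N))) ^ (1 / q)

/-- **Node `KineticWindowLDUniformBdd` — the crux's consequent for BOUNDED observables, tilt radius
uniform in the bound.** Verbatim `TwoClocks.KineticWindowLDUniform` except that `F` is additionally
bounded and the tilt radius is chosen from the growth constant `C` BEFORE `F`
(`∀ C ≥ 0 ∃ β₀ ∀ F`, `|F| ≤ B`, `|F| ≤ C(1+|v|²)`): what a cell transfer of a bounded observable yields
(localisation error `≤ 2B·#bad`), and what the truncation step needs (one radius for every truncation of a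
given `F`). -/
def KineticWindowLDUniformBdd : Prop :=
  ∃ η₀ : ℝ, 0 < η₀ ∧ ∀ (a θ₀ : T3 → ℝ) (u₀ : T3 → V3), Continuous a → Continuous θ₀ → Continuous u₀ →
    (∀ x, 0 < a x) → (∀ x, 0 < θ₀ x) → ∀ σ : ℝ, 0 < σ → σ ^ 3 * (⨆ x, a x) ≤ η₀ * ∫ x, a x →
    ∀ Φ : (N : ℕ) →
      HardSphereFlow (Literature.Analysis.FluidPDE.Torus.geometry (Fin 3)) (hsDiameter σ N) (N + 1),
    ∀ C : ℝ, 0 ≤ C → ∃ β₀ : ℝ, 0 < β₀ ∧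
    ∀ F : T3 × V3 → ℝ, Continuous F → (∃ B : ℝ, ∀ y, |F y| ≤ B) →
    (∀ y, |F y| ≤ C * (1 + ‖y.2‖ ^ 2)) →
    (∀ x, ∫ v, F (x, v) * localMaxwellian 1 (θ₀ x) (u₀ x) v = 0) →
    (∀ x (j : Fin 3), ∫ v, F (x, v) * v j * localMaxwellian 1 (θ₀ x) (u₀ x) v = 0) →
    (∀ x, ∫ v, F (x, v) * ‖v‖ ^ 2 * localMaxwellian 1 (θ₀ x) (u₀ x) v = 0) →
    ∀ β : ℝ, |β| ≤ β₀ → ∀ ε : ℝ, 0 < ε → ∃ τ : ℝ, 0 < τ ∧ ∃ N₀ : ℕ, ∀ N : ℕ, N₀ ≤ N →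
      ∫⁻ z, ENNReal.ofReal (Real.exp (β * ∑ i : Fin (N + 1),
          (τ * ((N : ℝ) + 1) ^ (-(1 / 3 : ℝ)))⁻¹ *
            ∫ r in (0 : ℝ)..(τ * ((N : ℝ) + 1) ^ (-(1 / 3 : ℝ))), F (((Φ N).flow r z) i)))
        ∂(localGibbsLaw σ a u₀ θ₀ N (Φ N)) ≤ ENNReal.ofReal (Real.exp (ε * ((N : ℝ) + 1)))

/-! ## §1 Stub statements (`@[stub "birth"]` obligation nodes; the admissible hypotheses of `LocalGibbsTransfer_of`) -/

/-- **Stub 1 statement — DENSITY-BAND UNIFORMISATION (the irreducible gap; hardest).** From the pointwise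
equilibrium window LD (`β₀ = β₀(σ, Φ, F)`) to a tilt radius uniform over compact density bands (and flows).
Why plausibly true: every constructive route to crux 2 (finite-window cluster / pruning expansions,
BGSSAnnals2023-type, at fixed small `σ`) produces thresholds depending on `σ` only through bounds, hence
band-uniform; the band-uniform statement is believed exactly as much as crux 2 itself. Why it might fail /
why it is a stub and not glue: NOT derivable from crux 2 as a black box — the only parameter the symmetry
group of the hard-sphere gas does not move is `σ`, and `σ ≠ σ'` are different dynamics with no `N`-uniform
comparison; a density-resonant slow one-body mode with `β₀(σ) → 0` at an interior density of `(0, σ₀)` would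
make crux 2 true and this false. Cheapest falsifier: exhibit, for the shear stress `φ(x)v¹v²`, a sequence
`σ_k → σ* > 0` along which the window pressure needs `β ≤ β_k → 0` (MD / kinetic caricature first). -/
-- @[stub "birth"] (tag live in the registered work copy `birth.lean` of the registrar seat; commented here: crux workfiles may not carry gate-reserved attributes)
def DensityBandUniformisation : Prop :=
  EquilibriumFastWindowLD → EquilibriumDensityBandLD

/-- **Stub 2 statement — FROZEN-CORE REDUCTION (soft; provable-grade, L).** From the band-uniform
equilibrium node to the frozen core: (i) instantiate at constants `(1, θ₀(x₀), u₀(x₀))` and the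
velocity-only observable `(x, v) ↦ F(x₀, v)`; (ii) Baire category in the Banach space of bounded continuous
admissible observables at the unit frame (cover = stub 1's node, closure / sum / scaling / symmetry = Hölder
in the observable priced by the static one-site Gaussian bound, which is `σ`- and flow-independent) gives a
radius uniform on weighted-sup-norm balls (`TransferEntropyClockBaire.uniform_radius_of_baire`,
`FastWindowRG.exists_uniform_range_of_baire`, landed); (iii) exact boost / thermal-scaling covariance of
hard-sphere flows and homogeneous Gibbs laws moves the frame `(θ₀(x₀), u₀(x₀))` to the unit frame at window
`√θ₀(x₀)·τ` (`TransferEntropyClockFrame.vMoment_frame`, `vMoment_drift`, `vMoment_thermal`, landed);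
(iv) window upgrade `∃ τ ⇒ ∃ τ₀ ∀ τ ≥ τ₀` at equilibrium (`TransferEntropyClockWindows.stub_windowUpgrade`,
landed) and flow independence (`lintegral_window_flow_indep`, landed); (v) thresholds `τ₀, N₀` uniform in
`x₀ ∈ 𝕋³` at fixed `σ` by compactness (uniform continuity of the truncated observable on `𝕋³ × B̄(0,L)`,
`TransferEntropyClockStatics.local_window_bound`, finite subcover) — verbatim the four-layer proof of the
landed `TransferEntropyClockFrame.stub_equilibriumFamily` (p136147) with the family parameter `s ∈ [0,t₁]`
replaced by `x₀ ∈ 𝕋³` and the structured class by general bounded admissible `F`. No `σ`-uniformity is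
manufactured here: the band enters and leaves with `β₀` only. Why it might fail: none known (pure
bookkeeping over landed mechanisms); the measurability of the path functional for a general continuous
`F` is the one technical point (`HardSphereFlowJointMeasurable`). -/
-- @[stub "birth"] (tag live in the registered work copy `birth.lean` of the registrar seat; commented here: crux workfiles may not carry gate-reserved attributes)
def FrozenCoreReduction : Prop :=
  EquilibriumDensityBandLD → FrozenEquilibriumCore

/-- **Stub 3 statement — RÉNYI QUASI-INVARIANCE OF THE LOCAL GIBBS LAW OVER A KINETIC WINDOW** (verbatim
the registered `stub_windowRenyi` of the sibling lines `Sketch` / `sigma-uniform-equilibrium-transfer` of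
crux stmt-AtomisticToContinuum-14662: ONE proof serves all three lines). For continuous positive profiles
and `σ ≤ 1/2` there is `p > 1` such that for every window parameter `τ`, every `δ > 0`, every flow family
and all large `N`, uniformly in `r ∈ [0, τ(N+1)^{-1/3}]`: `∫ (ψ∘Φ_{-r})^p ψ^{1-p} dL ≤ e^{pδ(N+1)}` (`ψ`
the canonical local Gibbs density, `L` Liouville). Free gas: true (dominated convergence); isothermal
profiles: conservation laws (landed `stub_windowTransfer_isothermal`); general profiles: "no LD-cheap energy /
momentum courier across `∇θ₀, ∇u₀` within a kinetic window" — research-level, decay-free (size L). By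
`L^p`–`L^q` duality it is EQUIVALENT to the consumable window transfer (`WindowTransfer`), so nothing weaker
closes the truncation and localisation steps under the non-invariant local law. -/
-- @[stub "birth"] (tag live in the registered work copy `birth.lean` of the registrar seat; commented here: crux workfiles may not carry gate-reserved attributes)
def WindowRenyiQuasiInvariance : Prop :=
    ∀ (a θ₀ : T3 → ℝ) (u₀ : T3 → V3), Continuous a → Continuous θ₀ → Continuous u₀ →
    (∀ x, 0 < a x) → (∀ x, 0 < θ₀ x) → ∀ σ : ℝ, 0 < σ → σ ≤ 1 / 2 →
    ∃ p : ℝ, 1 < p ∧ ∀ τ : ℝ, 0 < τ → ∀ δ : ℝ, 0 < δ →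
    ∀ Φ : (N : ℕ) →
      HardSphereFlow (Literature.Analysis.FluidPDE.Torus.geometry (Fin 3)) (hsDiameter σ N) (N + 1),
    ∃ N₀ : ℕ, ∀ N : ℕ, N₀ ≤ N → ∀ r ∈ Set.Icc (0 : ℝ) (τ * ((N : ℝ) + 1) ^ (-(1 / 3 : ℝ))),
      ∫⁻ z, ENNReal.ofReal (canonicalDensity (Literature.Analysis.FluidPDE.Torus.geometry (Fin 3))
            (hsDiameter σ N) (N + 1) (localGibbsProfile a u₀ θ₀) ((Φ N).flow (-r) z)) ^ p *
          ENNReal.ofReal (canonicalDensity (Literature.Analysis.FluidPDE.Torus.geometry (Fin 3))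
            (hsDiameter σ N) (N + 1) (localGibbsProfile a u₀ θ₀) z) ^ (1 - p)
        ∂(liouville (Literature.Analysis.FluidPDE.Torus.geometry (Fin 3)) (N + 1) (hsDiameter σ N)) ≤
      ENNReal.ofReal (Real.exp (p * (δ * ((N : ℝ) + 1))))

/-- **Stub 4 statement — LOCAL WINDOW INFLUENCE LOCALITY in bad-count currency, `Eventually` in the range,
uniform over compact families of data** (verbatim the registered `stub_localInfluence` of the sibling line
`sigma-uniform-equilibrium-transfer`, crux stmt-14662; local-Gibbs twin of the typed crux
`AntiMazurCoboundaries.InfluenceLocality` stmt-13916 in the `∃ R₀ ∀ R ≥ R₀` shape its disprover recommends).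
Particle `i` is BAD if at some `t ∈ [0, Tℓ_N]` its true state differs from its range-`Rℓ_N` cluster
forecast `localClusterState Ψ (Rℓ_N) t z i`; claim: `∫ exp(lam·#bad) dλ_k^N ≤ e^{δ(N+1)}` for `R ≥ R₀`,
`N ≥ N₀`, uniformly over a compact family `k`. This is the route's "CorridorLocality: finite speed of
influence at every exponential scale over vanishing windows". Used twice by stub 5 (`K = pt`: the given
local data; `K = 𝕋³ ×` the finite density net with CONSTANT profiles: the cell tori). Content: an
`N`-uniform exponential-moment bound at FIXED density on long time-ordered chains of scheduled pair
collisions; in print only Boltzmann–Grad / short times (Alexander1975, GST2013 Ch. 5, BGSSAnnals2023).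
Size L. -/
-- @[stub "birth"] (tag live in the registered work copy `birth.lean` of the registrar seat; commented here: crux workfiles may not carry gate-reserved attributes)
def LocalInfluenceLocality : Prop :=
    ∀ (K : Type) [TopologicalSpace K] [CompactSpace K]
      (a θ₀ : K → T3 → ℝ) (u₀ : K → T3 → V3) (s : K → ℝ),
      Continuous (Function.uncurry a) → Continuous (Function.uncurry θ₀) →
      Continuous (Function.uncurry u₀) → Continuous s →
      (∀ k x, 0 < a k x) → (∀ k x, 0 < θ₀ k x) → (∀ k, 0 < s k) → (∀ k, s k ≤ 1 / 2) →
    ∀ (T lam δ : ℝ), 0 < T → 0 < lam → 0 < δ → ∃ R₀ : ℝ, 0 < R₀ ∧ ∀ R : ℝ, R₀ ≤ R →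
    ∃ N₀ : ℕ, ∀ k : K, ∀ N : ℕ, N₀ ≤ N →
    ∀ (Φ : HardSphereFlow (Literature.Analysis.FluidPDE.Torus.geometry (Fin 3)) (hsDiameter (s k) N) (N + 1))
      (Ψ : (n : ℕ) →
        HardSphereFlow (Literature.Analysis.FluidPDE.Torus.geometry (Fin 3)) (hsDiameter (s k) N) n),
      ∫⁻ z, ENNReal.ofReal (Real.exp (lam *
          ((Finset.univ.filter fun i : Fin (N + 1) =>
              ∃ t ∈ Set.Icc (0 : ℝ) (T * ((N : ℝ) + 1) ^ (-(1 / 3 : ℝ))),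
                (Φ.flow t z) i ≠
                  localClusterState Ψ (R * ((N : ℝ) + 1) ^ (-(1 / 3 : ℝ))) t z i).card : ℝ)))
        ∂(localGibbsLaw (s k) (a k) (u₀ k) (θ₀ k) N Φ) ≤
      ENNReal.ofReal (Real.exp (δ * ((N : ℝ) + 1)))

/-- **Stub 5 statement — THE CELL–CORRIDOR TRANSFER ("CellwiseEquivalence")**: influence locality (stub 4),
the frozen equilibrium core and the window transfer imply the bounded-observable local node
`KineticWindowLDUniformBdd` (with `η₀ := min (σ₀³/16) (1/16)`). Proof plan (for the lead; ≤ 3 natural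
children): (T-a) under `λ_loc`: cells of side `δ(ε)` separated by corridors of width `κ(ε)`, 27-colour /
sub-lattice Hölder (KipnisLandim1999 Ch. 6 Lemma 1.8), corridor particles discarded deterministically
(`|F| ≤ B`, fraction `O(κ/δ)`), coefficients frozen at cell centres (static freezing, LANDED
`KineticCurrentsWindowLDUniformSigmaUniform.stub_staticFreezing`, + `WindowTransfer` to move static errors
through the window), localisation by the range-`Rℓ_N` forecast (`stub 4`, `K = pt`; error `≤ 2B·#bad`);
(T-b) grand-canonical passage and FACTORISATION over same-colour cells by the spatial Markov property of the
hard-core law given the corridor configuration (ensemble equivalence at LD scale, packing `≤ η₀`: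
Ruelle1969 Ch. 3–4, LebowitzPenrose1964), cell occupation large deviations as a product of one-cell bounds;
(T-c) per cell: comparison with the canonical law of a cell TORUS whose side and particle number are chosen
(configuration-dependently, union bound over polynomially many choices) so that its reduced density lies on
a FINITE net `{σ_m} ⊂ [σ₁, σ₂]` of mesh `√ε` fixed after `(β, ε)` (partition-function ratio
`e^{o(N_b)}` + occupation mismatch `≤ c·ε·N_b`), forecast = true torus dynamics up to `2B·#bad` (stub 4 with
the compact constant-profile family), rescaling to the unit torus (`σ'' = σ_m`, `τ'' = τσ_m/σ`, frame
unchanged) and the frozen core at `(x_b, σ_m)` — whose `β₀` is band-uniform (needed: the net is not known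
when `β₀` is fixed) while its `τ₀(σ_m), N₀(σ_m)` are maximised over the finite net (enough).
Size L–XL as a formalisation (hard-core DLR / grand-canonical statics in a region with boundary condition are
not yet in the tree — candidate definition request); the mathematics is standard. Why it might fail: none
known for bounded `F` — every step is kinematic or static once stubs 3–4 and the core are given. -/
-- @[stub "birth"] (tag live in the registered work copy `birth.lean` of the registrar seat; commented here: crux workfiles may not carry gate-reserved attributes)
def CellCorridorTransfer : Prop :=
  LocalInfluenceLocality → FrozenEquilibriumCore → WindowTransfer → KineticWindowLDUniformBdd

/-- **Stub 6 statement — QUADRATIC TRUNCATION** (bounded observables suffice): from the bounded node with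
bound-uniform radius to the crux's consequent. Given admissible `F` of growth `C`: soft velocity cutoff at
level `V(ε)`, re-orthogonalisation by five fixed bounded test directions `g_k = ψ_k e^{-|v|²}` (Gram matrix
against `1, v_j, |v|²` under `M_{1,u₀(x),θ₀(x)}` invertible and continuous in `x`), so `F = F̃_V + R_V` with
`F̃_V` bounded, continuous, admissible, of growth `2C` for EVERY `V` (hence ONE radius `β₀(2C)` from the
bounded node serves all truncations) and `|R_V| ≤ (C(1+|v|²) + c)·1_{|v| > V/2} + η(V)(1+|v|²)`,
`η(V) → 0`; Hölder splits `F̃_V` from `R_V`; Jensen in time + `WindowTransfer` + the static one-site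
Gaussian bound under the local Gibbs law price `R_V` by `e^{ε(N+1)}` for `V = V(ε)` large. Size M,
provable-grade (the sibling's class truncation `stub_classTruncation` p91214 is the structured-class
instance). Why it might fail: none known. -/
-- @[stub "birth"] (tag live in the registered work copy `birth.lean` of the registrar seat; commented here: crux workfiles may not carry gate-reserved attributes)
def QuadraticTruncation : Prop :=
  WindowTransfer → KineticWindowLDUniformBdd → KineticWindowLDUniform

/-! ## §2 Stubs (the ONLY sorries of the file) -/

/-- Stub 1 (OPEN, hardest): density-band uniformisation of the equilibrium window LD. -/
theorem stub_densityBandUniformisation : DensityBandUniformisation := by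
  sorry

/-- Stub 2 (OPEN, provable-grade L): Baire / covariance / window-upgrade reduction to the frozen core. -/
theorem stub_frozenCoreReduction : FrozenCoreReduction := by
  sorry

/-- Stub 3 (OPEN, L; SHARED — `WindowRenyiQuasiInvariance` is verbatim the signature of the sibling lines'
registered `stub_windowRenyi`, crux stmt-14662: one proof term serves both): Rényi quasi-invariance of the
local Gibbs law over a kinetic window. -/
theorem stub_windowRenyi : WindowRenyiQuasiInvariance := by
  sorry

/-- Stub 4 (OPEN, L; SHARED — `LocalInfluenceLocality` is verbatim the signature of the sibling line's
registered `stub_localInfluence`, crux stmt-14662: one proof term serves both): window influence locality in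
bad-count currency, uniform over compact families. -/
theorem stub_localInfluence : LocalInfluenceLocality := by
  sorry

/-- Stub 5 (OPEN, L–XL formalisation): the cell–corridor transfer. -/
theorem stub_cellCorridorTransfer : CellCorridorTransfer := by
  sorry

/-- Stub 6 (OPEN, provable-grade M): quadratic truncation. -/
theorem stub_quadraticTruncation : QuadraticTruncation := by
  sorry

/-! ## §3 Composition (kernel-checked; no sorry below this line) -/

/-- The window transfer in its consumable `L^q` form, from stub 3 by the LANDED glue
`KineticCurrentsWindowLDUniformSketch.stub_windowTransfer_of_renyi` (p89950). -/
theorem windowTransfer_of_renyi (h : WindowRenyiQuasiInvariance) : WindowTransfer :=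
  Summit.AtomisticToContinuum.HydrodynamicLimit.Theorems.KineticCurrentsWindowLDUniformSketch.stub_windowTransfer_of_renyi
    h

/-- **The line closes the crux modulo its six stubs**: density-band uniformisation of the equilibrium
input (stub 1), soft reduction to the frozen core (stub 2), the cell–corridor transfer (stub 5) fed by
influence locality (stub 4) and the window transfer (stub 3 + landed glue), and the quadratic truncation
(stub 6). The hypothesis `EquilibriumFastWindowLD` of the crux is consumed by stub 1. -/
theorem LocalGibbsTransfer_of (h₁ : DensityBandUniformisation) (h₂ : FrozenCoreReduction)
    (h₃ : WindowRenyiQuasiInvariance) (h₄ : LocalInfluenceLocality) (h₅ : CellCorridorTransfer)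
    (h₆ : QuadraticTruncation) :
    Summit.AtomisticToContinuum.HydrodynamicLimit.Theses.TwoClocks.LocalGibbsTransfer :=
  fun hE => h₆ (windowTransfer_of_renyi h₃) (h₅ h₄ (h₂ (h₁ hE)) (windowTransfer_of_renyi h₃))

/-- **Registered target of the skeleton** — the crux BY NAME with no hypotheses: `LocalGibbsTransfer_of`
applied to the six declared stubs (the sorries live in `stub_*` only; `#print axioms` of this theorem reaches
`sorryAx` exactly through them). `#h21_check_skeleton` keys on THIS theorem in both copies of the file (it is
enumerated before `LocalGibbsTransfer_of`, whose stub hypotheses are admissible only where the `@[stub]` tags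
of §1 are live — i.e. in the registrar's work copy; in the tree copy the tags are necessarily commented out,
since crux workfiles may not carry gate-reserved attributes). -/
theorem LocalGibbsTransfer_of_stubs :
    Summit.AtomisticToContinuum.HydrodynamicLimit.Theses.TwoClocks.LocalGibbsTransfer :=
  LocalGibbsTransfer_of stub_densityBandUniformisation stub_frozenCoreReduction stub_windowRenyi
    stub_localInfluence stub_cellCorridorTransfer stub_quadraticTruncation

end Summit.AtomisticToContinuum.HydrodynamicLimit.Cruxes.LocalGibbsTransfer.Birth

end
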